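import Literature.NumberTheory.EllipticCurves.IwasawaAlgebra
import Literature.NumberTheory.EllipticCurves.Rubin1991.TwoVariableMainConjecture
import Literature.NumberTheory.IwasawaTheory.IwasawaAlgebraTwoVarRegularProofs
import HarnessLib

/-!
# Line `thin_comb` on the WALL `AdditiveSplitIMCInclusionAtThree` (stmt-BirchSwinnertonDyer-20395) — stub
# `stub_charIdealPrincipal` CLOSED (`--supports stmt-BirchSwinnertonDyer-20395`; cell `pub/bsd-wall`, lead `cruxlead-20395` g2)

The registered skeleton `Cruxes/AdditiveSplitIMCInclusionAtThree/Lines/thin_comb.lean` (sha16 a79ece25ae7a9131) has the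
support stub `stub_charIdealPrincipal : ∀ M, (Module.charIdeal (IwasawaAlgebra₂ 3) M).IsPrincipal` — characteristic
ideals over the two-variable Iwasawa algebra `Λ₂ = ℤ₃⟦T₂⟧⟦T₁⟧` are principal (needed to PIN a generator `g` of
`ch_{Λ₂}(X_{∅,0}(E/K̃_∞))`). Proof = the tree's one-variable argument `charIdeal_isPrincipal_holds` (IwasawaAlgebra.lean)
run over `Λ₂`: `Λ₂` is factorial (tree `IwasawaTheory.uniqueFactorizationMonoid_iwasawaAlgebraTwoVar`, Matsumura 20.3),
so every height-one prime is principal (Mathlib `UniqueFactorizationMonoid.isPrincipal_of_height_eq_one`), hence so is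
each `𝔭 ^ n` and the `finprod` `Module.charIdeal Λ₂ M` (junk value `1 = ⊤` included). Stated for every prime `p`.

Nothing else of the line is addressed; BSD is not proved by any of this.
-/

set_option linter.dupNamespace false

noncomputable section

namespace Summit.BirchSwinnertonDyer.BirchSwinnertonDyer.Theorems.UniversalToricDescentThinCombLine

open Literature.NumberTheory.EllipticCurves

/-- Characteristic ideals over `Λ₂ = ℤ_p⟦T₂⟧⟦T₁⟧` are principal, for every prime `p` (UFD ⇒ height-one primes
principal ⇒ their finite-or-junk product of powers is principal). [cite: Washington1997, §13.2; Matsumura1987, Thm. 20.3] -/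
theorem charIdeal_iwasawaAlgebra₂_isPrincipal (p : ℕ) [Fact p.Prime] (M : Type*) [AddCommGroup M]
    [Module (IwasawaAlgebra₂ p) M] :
    (Literature.NumberTheory.EllipticCurves.Module.charIdeal (IwasawaAlgebra₂ p) M).IsPrincipal := by
  haveI : UniqueFactorizationMonoid (IwasawaAlgebra₂ p) :=
    Literature.NumberTheory.IwasawaTheory.uniqueFactorizationMonoid_iwasawaAlgebraTwoVar p
  unfold Module.charIdeal
  rw [← Ideal.mem_isPrincipalSubmonoid_iff]
  refine finprod_mem_induction (· ∈ Ideal.isPrincipalSubmonoid (IwasawaAlgebra₂ p))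
    (Submonoid.one_mem _) (fun _ _ hx hy => Submonoid.mul_mem _ hx hy) ?_
  intro 𝔭 h𝔭
  refine Submonoid.pow_mem _ ?_ _
  obtain ⟨g, hg⟩ := UniqueFactorizationMonoid.isPrincipal_of_height_eq_one h𝔭
  rw [hg]
  exact Ideal.span_singleton_mem_isPrincipalSubmonoid g

/-- **`stub_charIdealPrincipal` of line `thin_comb`, closed** (verbatim the registered signature, `p = 3`).
[cite: Washington1997, §13.2; Matsumura1987, Thm. 20.3] -/
theorem stub_charIdealPrincipal :
    ∀ (M : Type) [AddCommGroup M] [Module (IwasawaAlgebra₂ 3) M],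
      (Literature.NumberTheory.EllipticCurves.Module.charIdeal (IwasawaAlgebra₂ 3) M).IsPrincipal :=
  fun M _ _ => charIdeal_iwasawaAlgebra₂_isPrincipal 3 M

end Summit.BirchSwinnertonDyer.BirchSwinnertonDyer.Theorems.UniversalToricDescentThinCombLine

end
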